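import Literature.Analysis.FluidPDE.CheskidovNoAnomalyEstimates
import Literature.Analysis.FluidPDE.CheskidovNoAnomalyFamily
import Literature.Analysis.FluidPDE.PassiveScalarWellPosedness
import Literature.Analysis.FluidPDE.CheskidovScalarEstimates
import Literature.Analysis.FluidPDE.QuasiSelfSimilarMixing
import HarnessLib

/-!
# Cheskidov's planar no-anomaly family: the reduction to Thm. 3.1 and parabolic well-posedness (arXiv:2311.04182, §3–§4)

Topic `Literature/Analysis/FluidPDE` (family `turb`). This file PROVES the named fact
`Literature.Analysis.FluidPDE.cheskidov_noAnomaly_family` (the planar core of Cheskidov 2023,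
Thm. 2.1 with energy level `e = 0`, behind the barrier
`Literature.Barriers.AnomalousDissipation.Cheskidov2023_thm21_noDissipationAnomaly`) FROM its two
published ingredients, both vendored as named facts:

* `Literature.Analysis.FluidPDE.alberti_crippa_mazzucato_family` — the quasi-self-similar mixing
  family (Alberti–Crippa–Mazzucato 2019; as printed in Bruè–De Lellis 2023, Thm. 4.1 and
  Cheskidov 2023, Thm. 3.1), and
* `Literature.Analysis.FluidPDE.Torus.exists_unique_isClassicalScalarTransportForcedOn` —
  classical well-posedness of advection–diffusion with smooth drift on the torus (Krylov 1996,
  Thm. 9.2.3; the sentence "let `θ^m` be the unique smooth solution of (4.2)" of §4),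

`cheskidov_noAnomaly_family_of_acm : alberti_crippa_mazzucato_family →
  Torus.exists_unique_isClassicalScalarTransportForcedOn (d := Fin 2) → cheskidov_noAnomaly_family`,

so that the trust base of the barrier is exactly these two standard results. The witnesses are
those of the source (§3 (3.4)–(3.13), §4 p. 12), realised by the landed gluing
(`CheskidovGluedFamily`, `CheskidovForces`, `CheskidovLimitDrift`): `v^m = Gluing.drift v m`,
`ρ^m = Gluing.profile ρ m`, `(ṽ, ρ̃) = (Gluing.limDrift v, Gluing.limProfile ρ)`, `ρ_in = ρ₀(0)`,
`θ^m` the viscous solutions on `[0,2]`, `g = Gluing.limForce v`, with viscosities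
`ν_m = ((m+2)³125ᵐ)⁻¹` (`≤ m⁻¹λ_m⁻²`, the "low" viscosities (4.19); the source's argument works for
any `ν_m ≲ m⁻¹λ_m⁻²`). The clauses: transport and smoothness (landed); the energy equality
(`IsClassicalScalarTransportOn.scalarL2Sq_add_scalarDissipation_holds`); the closeness (4.3)
through `IsClassicalScalarTransportOn.integral_sub_sq_le` (`CheskidovScalarEstimates`) and
`scalarGradNormSq (ρ^m) ≤ (Cλ_m)²`: `∫(θ^m-ρ^m)² ≤ ν_mC²λ_m² → 0` uniformly on `[0,2]`; Lemma 3.2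
(3.16); the blow-up (3.10) and the weak limit; and the force convergence in `C([0,2]; C^α)` for
every `α ∈ (0,1)` by the case analysis of `nsBodyForce_drift_sub_limForce*` (p. 10 / BDL
Lemma 5.1): on the blocks `n ≤ m` the difference is the viscous term `-ν_mΔ(blockDrift v n)`, on
the blocks `n > m` it is `-blockForce v n` whose `C^α` norm decays along the blocks, and it
vanishes on `[1,2]` (`CheskidovNoAnomalyEstimates`).

## References

* A. Cheskidov, arXiv:2311.04182 (2023), Thm. 2.1, Thm. 3.1, §3, §4 pp. 12–13, (4.19)–(4.20).
* E. Bruè, C. De Lellis, Comm. Math. Phys. 400 (2023), Thm. 4.1, Lemma 5.1.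
* G. Alberti, G. Crippa, A. L. Mazzucato, J. Amer. Math. Soc. 32 (2019).
* N. V. Krylov, *Lectures on Elliptic and Parabolic Equations in Hölder Spaces* (1996), Thm. 9.2.3.
-/

noncomputable section

open MeasureTheory Set Filter
open _root_.Topology
open scoped ENNReal NNReal ContDiff InnerProductSpace

namespace Literature.Analysis.FluidPDE.Gluing

open Literature.Analysis.FunctionSpaces

variable {d : Type*} [Fintype d] [DecidableEq d]

section Assembly

omit [Fintype d] [DecidableEq d] in
/-- Tails of a null sequence: `sup_{n > m} G n → 0` in `ℝ≥0∞` if `G n → 0`. [folklore] -/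
theorem tendsto_iSup_tail {G : ℕ → ℝ} (hG : Tendsto G atTop (𝓝 0)) :
    Tendsto (fun m => ⨆ n, ⨆ (_ : m < n), ENNReal.ofReal (G n)) atTop (𝓝 0) := by
  rw [ENNReal.tendsto_nhds_zero]
  intro ε hε
  by_cases hε' : ε = ⊤
  · exact Eventually.of_forall fun m => hε' ▸ le_top
  have hε2 : 0 < ε.toReal := ENNReal.toReal_pos hε.ne' hε'
  have hev : ∀ᶠ n in atTop, G n < ε.toReal := (tendsto_order.1 hG).2 _ hε2
  obtain ⟨N, hN⟩ := eventually_atTop.1 hev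
  refine eventually_atTop.2 ⟨N, fun m hm => iSup₂_le fun n hn => ?_⟩
  calc ENNReal.ofReal (G n) ≤ ENNReal.ofReal ε.toReal := ENNReal.ofReal_le_ofReal (hN n (by omega)).le
    _ ≤ ε := ENNReal.ofReal_toReal_le

omit [Fintype d] [DecidableEq d] in
/-- The viscosities `ν_m = ((m+2)³ 125ᵐ)⁻¹` tend to zero. [folklore] -/
theorem tendsto_visc : Tendsto (fun m : ℕ => (((m : ℝ) + 2) ^ 3 * 125 ^ m)⁻¹) atTop (𝓝 0) := by
  have h : ∀ m : ℕ, (((m : ℝ) + 2) ^ 3 * 125 ^ m)⁻¹ ≤ 1 / ((m : ℝ) + 1) := by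
    intro m
    rw [inv_eq_one_div, div_le_div_iff₀ (by positivity) (by positivity), one_mul, one_mul]
    have h1 : (1 : ℝ) ≤ 125 ^ m := one_le_pow₀ (by norm_num)
    have h2 : (m : ℝ) + 1 ≤ ((m : ℝ) + 2) ^ 3 := by nlinarith [m.cast_nonneg (α := ℝ), sq_nonneg ((m : ℝ) + 2)]
    exact h2.trans (le_mul_of_one_le_right (by positivity) h1)
  exact squeeze_zero (fun m => by positivity) h tendsto_one_div_add_atTop_nhds_zero_nat

open Literature.Analysis.FluidPDE.Torus (nsBodyForce)

/-- **Cheskidov's planar no-anomaly family from its ingredients** (arXiv:2311.04182, §3–§4, the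
planar core of Thm. 2.1 with `e = 0`). From blocks `(ρₙ, vₙ)` — classical transport solutions on
`[0,1] × T²` handed over continuously (`Blocks`), with the scalar properties of Thm. 3.1 (b)
(zero mean, unit `L²` norm, `|ρₙ| ≤ 10`, `‖∇ρₙ‖ ≤ Cλₙ`, `‖ρₙ‖_{Ḣ⁻¹} ≤ Cλₙ⁻¹`) and the velocity
bounds `BlockDerivBounds` of Thm. 3.1 (a) — and classical parabolic well-posedness on `T²`
(`Torus.exists_unique_isClassicalScalarTransportForcedOn`, Krylov 1996 Thm. 9.2.3), the fact
`cheskidov_noAnomaly_family` follows with the witnesses of the source: `v^m = drift v m`,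
`ρ^m = profile ρ m`, `(ṽ, ρ̃) = (limDrift v, limProfile ρ)`, `ρ_in = ρ₀(0)`, `θ^m` the viscous
solutions on `[0,2]` with `ν_m = ((m+2)³125ᵐ)⁻¹ ≤ m⁻¹λ_m⁻²` (the "low" viscosities (4.19); any
`ν_m ≲ m⁻¹λ_m⁻²` do), `g = limForce v`; (4.3) through
`IsClassicalScalarTransportOn.integral_sub_sq_le`, Lemma 3.2 (3.16), the blow-up (3.10) and the
`C([0,2]; C^α)` force convergence by the case analysis of `nsBodyForce_drift_sub_limForce*`
(viscous term on the blocks `≤ m`, decaying block force on the blocks `> m`, zero on `[1,2]`). [cite: Cheskidov2023, Thm. 2.1, §3 and §4 pp. 12–13] -/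
theorem _root_.Literature.Analysis.FluidPDE.cheskidov_noAnomaly_family_of_blocks
    {ρb : ℕ → ℝ → UnitAddTorus (Fin 2) → ℝ}
    {vb : ℕ → ℝ → UnitAddTorus (Fin 2) → EuclideanSpace ℝ (Fin 2)} {A : ℝ} (hB : Blocks ρb vb)
    (hb : ∀ n : ℕ, ∀ s ∈ Icc (0 : ℝ) 1,
      Torus.HasZeroMean (ρb n s) ∧ ∫ x, ρb n s x ^ 2 = 1 ∧ ∀ x, |ρb n s x| ≤ 10)
    (hCH : ∃ C : ℝ, ∀ n : ℕ, ∀ s ∈ Icc (0 : ℝ) 1,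
      (∀ x, ‖Torus.gradient (ρb n s) x‖ ≤ C * 5 ^ n) ∧
      Torus.eHomSobolevSeminorm (-1) (fun x => (ρb n s x : ℂ)) ≤ ENNReal.ofReal (C * (5 ^ n)⁻¹))
    (hK : BlockDerivBounds vb A)
    (hwp : Torus.exists_unique_isClassicalScalarTransportForcedOn (d := Fin 2)) :
    cheskidov_noAnomaly_family := by
  classical
  obtain ⟨C, hCH⟩ := hCH
  have hC : ∀ n : ℕ, ∀ s ∈ Icc (0 : ℝ) 1, ∀ x, ‖Torus.gradient (ρb n s) x‖ ≤ C * 5 ^ n :=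
    fun n s hs => (hCH n s hs).1
  have hH : ∀ n : ℕ, ∀ s ∈ Icc (0 : ℝ) 1,
      Torus.eHomSobolevSeminorm (-1) (fun x => (ρb n s x : ℂ)) ≤ ENNReal.ofReal (C * (5 ^ n)⁻¹) :=
    fun n s hs => (hCH n s hs).2
  -- gluing constants
  obtain ⟨Bσ, hBσ0, hBσ⟩ := exists_forall_abs_deriv_sigma_le
  obtain ⟨Bσ', hBσ'0, hBσ'⟩ := exists_forall_abs_deriv_deriv_sigma_le
  have hv : ∀ n, Torus.IsSmoothSpaceTimeOn (Icc 0 1) (vb n) := fun n => (hB.sol n).smooth_velocity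
  have hA := hK.nonneg
  -- viscosities
  set ν : ℕ → ℝ := fun m => (((m : ℝ) + 2) ^ 3 * 125 ^ m)⁻¹ with hν
  have hνpos : ∀ m, 0 < ν m := fun m => by positivity
  -- the datum
  set ρin : UnitAddTorus (Fin 2) → ℝ := ρb 0 0 with hρin
  have hρin_smooth : Torus.IsSmooth ρin := (hB.sol 0).smooth_scalar.isSmooth_slice ⟨le_rfl, zero_le_one⟩
  -- the viscous scalars from well-posedness
  have hθex : ∀ m, ∃ θ : ℝ → UnitAddTorus (Fin 2) → ℝ,
      Torus.IsClassicalScalarTransportOn (Icc 0 2) (ν m) (drift vb m) θ ∧ θ 0 = ρin := by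
    intro m
    obtain ⟨θ, hθ, hθ0, -⟩ := Torus.exists_unique_isClassicalScalarTransportOn_of_forced hwp (hνpos m)
      two_pos ((isSmoothSpaceTimeOn_drift hB m).mono (subset_univ _))
      (fun t _ => isDivFree_drift hB m t) hρin_smooth
    exact ⟨θ, hθ, hθ0⟩
  choose θ hθ hθ0 using hθex
  have hρsol : ∀ m, Torus.IsClassicalScalarTransportOn (Icc 0 2) 0 (drift vb m) (profile ρb m) :=
    fun m => isClassicalScalarTransportOn_profile hB m (uniqueDiffOn_Icc (by norm_num))
  -- the bound
  set A₁ : ℝ := Bσ' * A + Bσ ^ 2 * (A + Fintype.card (Fin 2) * A ^ 2) with hA₁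
  set B : ℝ := max (2 * Bσ * A) (8 * A₁) with hBdef
  refine ⟨ν, drift vb, ρin, θ, profile ρb, limDrift vb, limProfile ρb, limForce vb, B, hνpos, tendsto_visc,
    isSmoothSpaceTimeOn_drift hB, fun m t => isDivFree_drift hB m t,
    fun m t ht => drift_eq_zero_of_not_mem vb ht, hρin_smooth, (hb 0 0 ⟨le_rfl, zero_le_one⟩).2.1,
    fun m => ⟨hθ m, hθ0 m⟩, ?energy, fun m => ⟨hρsol m, profile_zero ρb⟩, ?frozen,
    fun m t _ => ⟨(profile_slice hB hb m t).1, (profile_slice hB hb m t).2.1⟩, ?hm1, ?stat,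
    isClassicalScalarTransportOn_lim hB, ?bdd, fun t _ => (limProfile_slice hb hH t).2.1,
    tendsto_integral_norm_sq_limDrift hK.toBlockBounds hBσ,
    fun w hw => tendsto_integral_limProfile_mul hB hb hH hw,
    ?close, ?dissv, fun t ht x => limForce_eq_timeDerivWithin_add_convect hB ht x,
    fun t ht => limForce_eq_zero_of_one_le vb ht.1, ?gbdd, ?force⟩
  case energy =>
    intro m t ht
    have h := Torus.IsClassicalScalarTransportOn.scalarL2Sq_add_scalarDissipation_holds (hθ m) ht.1
      (Icc_subset_Icc le_rfl ht.2)
    simp only [Torus.scalarL2Sq, Torus.scalarDissipation, hθ0 m] at h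
    rw [(hb 0 0 ⟨le_rfl, zero_le_one⟩).2.1] at h
    linarith
  case frozen =>
    intro m t ht
    rw [profile_eq_of_ge hB ((tn_lt_one _).le.trans ht.1), profile_eq_of_ge hB (tn_lt_one _).le]
  case hm1 =>
    refine ⟨C, fun m => ?_⟩
    rw [profile_eq_of_ge hB (tn_lt_one _).le]
    exact hH m 1 ⟨zero_le_one, le_rfl⟩
  case stat =>
    intro T hT
    exact ⟨blockIdx T, fun m hm t ht => drift_eq_limDrift_and_profile_eq_limProfile hB hT hm ht.2⟩
  case bdd =>
    intro t _ x
    exact ⟨(norm_limDrift_le hK.toBlockBounds hBσ t x).trans (le_max_left _ _), (limProfile_slice hb hH t).2.2.1 x⟩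
  case gbdd =>
    intro t _ x
    exact (norm_limForce_le_const hB hK hBσ hBσ' t x).trans (le_max_right _ _)
  case close =>
    -- (4.3): `∫ (θ^m - ρ^m)²(t) ≤ ν_m C² 25ᵐ → 0` uniformly on `[0,2]`
    have hbound : ∀ m, ∀ t ∈ Icc (0 : ℝ) 2,
        ∫ x, (θ m t x - profile ρb m t x) ^ 2 ≤ ν m * (C * 5 ^ m) ^ 2 := by
      intro m t ht
      have h := Torus.IsClassicalScalarTransportOn.integral_sub_sq_le (hθ m) (hρsol m) (hνpos m).le subset_rfl
        (by rw [hθ0 m, profile_zero]) ht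
      refine h.trans ?_
      rw [Torus.scalarDissipation]
      have hint : ‖∫ s in (0 : ℝ)..t, Torus.scalarGradNormSq (profile ρb m s)‖ ≤ (C * 5 ^ m) ^ 2 * |t - 0| :=
        intervalIntegral.norm_integral_le_of_norm_le_const fun s _ => by
          rw [Real.norm_eq_abs, abs_of_nonneg (Torus.scalarGradNormSq_nonneg _)]
          exact scalarGradNormSq_profile_le_sq hB hC m s
      rw [sub_zero, abs_of_nonneg ht.1, Real.norm_eq_abs] at hint
      have hle := (le_abs_self _).trans hint
      have hν0 := (hνpos m).le
      calc ν m * (∫ s in (0 : ℝ)..t, Torus.scalarGradNormSq (profile ρb m s)) / 2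
          ≤ ν m * ((C * 5 ^ m) ^ 2 * t) / 2 := by gcongr
        _ ≤ ν m * ((C * 5 ^ m) ^ 2 * 2) / 2 := by gcongr; exact ht.2
        _ = ν m * (C * 5 ^ m) ^ 2 := by ring
    have hlim : Tendsto (fun m => ENNReal.ofReal (Real.sqrt (ν m * (C * 5 ^ m) ^ 2))) atTop (𝓝 0) := by
      have h1 : Tendsto (fun m : ℕ => ν m * (C * 5 ^ m) ^ 2) atTop (𝓝 0) := by
        have heq : ∀ m : ℕ, ν m * (C * 5 ^ m) ^ 2 = C ^ 2 * ((((m : ℝ) + 2) ^ 3)⁻¹ * (5⁻¹ : ℝ) ^ m) := by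
          intro m
          simp only [hν]
          have h125 : (125 : ℝ) ^ m = 5 ^ m * 5 ^ m * 5 ^ m := by rw [← mul_pow, ← mul_pow]; norm_num
          rw [h125, inv_pow]
          have h5 : (5 : ℝ) ^ m ≠ 0 := by positivity
          have hm : ((m : ℝ) + 2) ^ 3 ≠ 0 := by positivity
          field_simp
        have h2 : Tendsto (fun m : ℕ => (((m : ℝ) + 2) ^ 3)⁻¹ * (5⁻¹ : ℝ) ^ m) atTop (𝓝 0) := by
          have hb' : ∀ m : ℕ, (((m : ℝ) + 2) ^ 3)⁻¹ * (5⁻¹ : ℝ) ^ m ≤ (5⁻¹ : ℝ) ^ m := fun m => by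
            have : (((m : ℝ) + 2) ^ 3)⁻¹ ≤ 1 := inv_le_one_of_one_le₀ (one_le_pow₀ (by linarith [m.cast_nonneg (α := ℝ)]))
            exact (mul_le_of_le_one_left (by positivity) this)
          exact squeeze_zero (fun m => by positivity) hb'
            (tendsto_pow_atTop_nhds_zero_of_lt_one (by norm_num) (by norm_num))
        have := h2.const_mul (C ^ 2)
        rw [mul_zero] at this
        exact this.congr fun m => (heq m).symm
      have h2 := (Real.continuous_sqrt.tendsto 0).comp h1
      rw [Real.sqrt_zero] at h2
      have h3 := ENNReal.tendsto_ofReal h2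
      rwa [ENNReal.ofReal_zero] at h3
    refine tendsto_of_tendsto_of_tendsto_of_le_of_le tendsto_const_nhds hlim (fun _ => bot_le) fun m => ?_
    refine iSup₂_le fun t ht => ?_
    have hmem : MemLp (θ m t - profile ρb m t) 2 volume :=
      (((hθ m).smooth_scalar.isSmooth_slice ht).sub ((hρsol m).smooth_scalar.isSmooth_slice ht)).memLp 2
    rw [eLpNorm_two_eq_ofReal_sqrt_integral_sq hmem]
    exact ENNReal.ofReal_le_ofReal (Real.sqrt_le_sqrt (by simpa using hbound m t ht))
  case dissv =>
    -- Lemma 3.2, (3.16): `ν_m ∫₀² ‖∇v^m‖² → 0`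
    have hbound : ∀ m, |ν m * ∫ t in (0 : ℝ)..2, Torus.gradNormSq (drift vb m t)| ≤
        ν m * (2 * (Fintype.card (Fin 2) * (Bσ * (((m : ℝ) + 1) * (m + 2)) * A) ^ 2)) := by
      intro m
      have hint : ‖∫ t in (0 : ℝ)..2, Torus.gradNormSq (drift vb m t)‖ ≤
          (Fintype.card (Fin 2) * (Bσ * (((m : ℝ) + 1) * (m + 2)) * A) ^ 2) * |2 - 0| :=
        intervalIntegral.norm_integral_le_of_norm_le_const fun s _ => by
          rw [Real.norm_eq_abs, abs_of_nonneg (Torus.gradNormSq_nonneg _)]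
          exact gradNormSq_drift_le hB hK hBσ m s
      rw [abs_mul, abs_of_pos (hνpos m)]
      refine mul_le_mul_of_nonneg_left ?_ (hνpos m).le
      rw [Real.norm_eq_abs, sub_zero, abs_two] at hint
      linarith [hint, le_abs_self (∫ t in (0 : ℝ)..2, Torus.gradNormSq (drift vb m t))]
    have hlim : Tendsto (fun m : ℕ => ν m * (2 * (Fintype.card (Fin 2) *
        (Bσ * (((m : ℝ) + 1) * (m + 2)) * A) ^ 2))) atTop (𝓝 0) := by
      have heq : ∀ m : ℕ, ν m * (2 * (Fintype.card (Fin 2) * (Bσ * (((m : ℝ) + 1) * (m + 2)) * A) ^ 2)) =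
          (2 * Fintype.card (Fin 2) * (Bσ * A) ^ 2) *
            ((((m : ℝ) + 1) * (m + 2)) ^ 2 * (((m : ℝ) + 2) ^ 3 * 125 ^ m)⁻¹) := by
        intro m; simp only [hν]; ring
      have hb' : ∀ m : ℕ, (((m : ℝ) + 1) * (m + 2)) ^ 2 * (((m : ℝ) + 2) ^ 3 * 125 ^ m)⁻¹ ≤
          8 * (25⁻¹ : ℝ) ^ m := by
        intro m
        have h1 := sq_succ_mul_succ_le_eight_mul_pow m
        have h2 : (((m : ℝ) + 2) ^ 3 * 125 ^ m)⁻¹ ≤ (125 ^ m)⁻¹ := by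
          apply inv_anti₀ (by positivity)
          have : (1 : ℝ) ≤ ((m : ℝ) + 2) ^ 3 := one_le_pow₀ (by linarith [m.cast_nonneg (α := ℝ)])
          nlinarith [pow_pos (by norm_num : (0 : ℝ) < 125) m]
        calc _ ≤ (8 * 5 ^ m) * (125 ^ m)⁻¹ := mul_le_mul h1 h2 (by positivity) (by positivity)
          _ = 8 * (25⁻¹ : ℝ) ^ m := by
            rw [show (125 : ℝ) ^ m = 25 ^ m * 5 ^ m by rw [← mul_pow]; norm_num, inv_pow]
            field_simp
      have h0 : Tendsto (fun m : ℕ => (((m : ℝ) + 1) * (m + 2)) ^ 2 * (((m : ℝ) + 2) ^ 3 * 125 ^ m)⁻¹)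
          atTop (𝓝 0) := by
        refine squeeze_zero (fun m => by positivity) hb' ?_
        have := (tendsto_pow_atTop_nhds_zero_of_lt_one (by norm_num : (0 : ℝ) ≤ 25⁻¹) (by norm_num)).const_mul 8
        rwa [mul_zero] at this
      have := h0.const_mul (2 * Fintype.card (Fin 2) * (Bσ * A) ^ 2)
      rw [mul_zero] at this
      exact this.congr fun m => (heq m).symm
    exact squeeze_zero_norm (fun m => by rw [Real.norm_eq_abs]; exact hbound m) hlim
  case force =>
    intro α hα0 hα1
    have hα1' : α ≤ 1 := hα1.le
    -- the two error terms
    set E : ℝ := ((Fintype.card (Fin 2) * A + 1) +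
      (Real.sqrt (Fintype.card (Fin 2)) * Fintype.card (Fin 2) ^ 2 * A + 1) *
        (2 * Fintype.card (Fin 2) * A + 1)) with hE
    set ε₁ : ℕ → ℝ≥0∞ := fun m => ENNReal.ofReal (ν m * (Bσ * (((m : ℝ) + 1) * (m + 2)) * (E * 125 ^ m))) with hε₁
    set A₂ : ℝ := Bσ' * A + Bσ ^ 2 * (A + 2 * Fintype.card (Fin 2) * A ^ 2) with hA₂
    set G : ℕ → ℝ := fun n => (((n : ℝ) + 1) * (n + 2)) ^ 2 * (5 ^ n)⁻¹ * A₁ +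
      (Real.sqrt (Fintype.card (Fin 2)) * (Fintype.card (Fin 2) * ((((n : ℝ) + 1) * (n + 2)) ^ 2 * A₂))) ^ (α : ℝ) *
        (2 * ((((n : ℝ) + 1) * (n + 2)) ^ 2 * (5 ^ n)⁻¹ * A₁)) ^ (1 - (α : ℝ)) with hG
    set ε₂ : ℕ → ℝ≥0∞ := fun m => ⨆ n, ⨆ (_ : m < n), ENNReal.ofReal (G n) with hε₂
    -- both tend to zero
    have hε₁lim : Tendsto ε₁ atTop (𝓝 0) := by
      have heq : ∀ m : ℕ, ν m * (Bσ * (((m : ℝ) + 1) * (m + 2)) * (E * 125 ^ m)) =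
          (Bσ * E) * (((m : ℝ) + 1) * (m + 2) * (((m : ℝ) + 2) ^ 3)⁻¹) := by
        intro m; simp only [hν]; field_simp
      have hb' : ∀ m : ℕ, ((m : ℝ) + 1) * (m + 2) * (((m : ℝ) + 2) ^ 3)⁻¹ ≤ 1 / ((m : ℝ) + 1) := by
        intro m
        rw [← div_eq_mul_inv, div_le_div_iff₀ (by positivity) (by positivity)]
        nlinarith [m.cast_nonneg (α := ℝ)]
      have h0 : Tendsto (fun m : ℕ => ((m : ℝ) + 1) * (m + 2) * (((m : ℝ) + 2) ^ 3)⁻¹) atTop (𝓝 0) :=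
        squeeze_zero (fun m => by positivity) hb' tendsto_one_div_add_atTop_nhds_zero_nat
      have h1 := h0.const_mul (Bσ * E)
      rw [mul_zero] at h1
      have h2 := ENNReal.tendsto_ofReal (h1.congr fun m => (heq m).symm)
      rwa [ENNReal.ofReal_zero] at h2
    have hε₂lim : Tendsto ε₂ atTop (𝓝 0) := by
      refine tendsto_iSup_tail ?_
      have hB' := nonneg_of_abs_deriv_deriv_sigma_le hBσ'
      have := tendsto_profileForceBound (A₁ := A₁) (A₂ := A₂)
        (c := Real.sqrt (Fintype.card (Fin 2)) * Fintype.card (Fin 2)) (r := α)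
        (by positivity) (by positivity) (by positivity) (by exact_mod_cast hα1)
      refine this.congr fun n => ?_
      simp only [hG]; ring_nf
    have hsum : Tendsto (fun m => ε₁ m + ε₂ m) atTop (𝓝 0) := by
      simpa using hε₁lim.add hε₂lim
    refine tendsto_of_tendsto_of_tendsto_of_le_of_le tendsto_const_nhds hsum (fun _ => bot_le) fun m => ?_
    refine iSup₂_le fun t ht => ?_
    -- case analysis on `t`
    rcases lt_or_ge t (tn (m + 1)) with h1 | h1
    · -- blocks `≤ m`: the viscous term
      have ht1 : t < 1 := h1.trans_le (tn_lt_one _).le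
      have hmem := mem_Ico_tn_blockIdx ht.1 ht1
      have hjm : blockIdx t ≤ m := blockIdx_le_of_lt_tn_succ h1
      have hfun : nsBodyForce (ν m) (drift vb m) t - limForce vb t =
          (-1 : ℝ) • fun x => ν m • Torus.laplacian (blockDrift vb (blockIdx t) t) x := by
        funext x
        rw [Pi.sub_apply, Pi.smul_apply, nsBodyForce_drift_sub_limForce hB (ν m) hjm hmem x, neg_one_smul]
      rw [hfun, eBoundedHolderNorm_const_smul]
      simp only [enorm_neg, enorm_one, one_mul]
      exact (eBoundedHolderNorm_viscous_le (hv _) hK hBσ hjm (hνpos m).le t hα1').trans le_self_add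
    · rcases lt_or_ge t 1 with h2 | h2
      · -- blocks `> m`: the block force alone
        have hfun : nsBodyForce (ν m) (drift vb m) t - limForce vb t =
            (-1 : ℝ) • blockForce vb (blockIdx t) t := by
          funext x
          rw [Pi.sub_apply, Pi.smul_apply, nsBodyForce_drift_sub_limForce_of_ge hB (ν m) h1 h2 x, neg_one_smul]
        rw [hfun, eBoundedHolderNorm_const_smul]
        simp only [enorm_neg, enorm_one, one_mul]
        have hn : m < blockIdx t := Nat.lt_of_succ_le (le_blockIdx_of_tn_le h1 h2)
        have hbd := (blockForce_bounds (hv (blockIdx t)) hK hBσ hBσ' t hα1').2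
        refine (hbd.trans ?_).trans le_add_self
        exact le_iSup₂ (f := fun n (_ : m < n) => ENNReal.ofReal (G n)) (blockIdx t) hn
      · -- `t ≥ 1`: everything vanishes
        have hfun : nsBodyForce (ν m) (drift vb m) t - limForce vb t = 0 := by
          funext x
          rw [Pi.sub_apply, nsBodyForce_drift_sub_limForce_of_not_mem hB (ν m) (Or.inr h2) x]; rfl
        rw [hfun, eBoundedHolderNorm_zero]
        exact bot_le

/-- **Cheskidov's planar no-anomaly family from the Alberti–Crippa–Mazzucato family and parabolic
well-posedness** (arXiv:2311.04182, §3–§4): the reduction of the named fact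
`cheskidov_noAnomaly_family` to `alberti_crippa_mazzucato_family` (Cheskidov 2023, Thm. 3.1 =
Bruè–De Lellis 2023, Thm. 4.1, per-level supports) and
`Torus.exists_unique_isClassicalScalarTransportForcedOn` (Krylov 1996, Thm. 9.2.3). [cite: Cheskidov2023, Thm. 2.1 and Thm. 3.1] -/
theorem _root_.Literature.Analysis.FluidPDE.cheskidov_noAnomaly_family_of_acm (h₁ : alberti_crippa_mazzucato_family)
    (h₂ : Torus.exists_unique_isClassicalScalarTransportForcedOn (d := Fin 2)) :
    cheskidov_noAnomaly_family := by
  obtain ⟨ρ, v, hsol, ha, ha', hb, hC, -, hd⟩ := h₁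
  obtain ⟨A, hK⟩ := exists_blockDerivBounds (fun n => (hsol n).smooth_velocity) ha ha'
  exact cheskidov_noAnomaly_family_of_blocks ⟨hsol, hd⟩ hb hC hK h₂

/-- **Deprecated** (2026-08-16) with its hypothesis, the mis-stated `n`-uniform-support reading of
Bruè–De Lellis Thm. 4.1 (c) (`alberti_crippa_mazzucato_quasi_self_similar`, deprecated in
`QuasiSelfSimilarMixing.lean`): use `cheskidov_noAnomaly_family_of_acm` (per-level family).
*Content (unchanged):* the same reduction from that reading, which implies the per-level family. [cite: BrueDeLellisCMP2023, Thm. 4.1] -/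
@[deprecated Literature.Analysis.FluidPDE.cheskidov_noAnomaly_family_of_acm (since := "2026-08-16")]
theorem _root_.Literature.Analysis.FluidPDE.cheskidov_noAnomaly_family_of_quasi_self_similar
    (h₁ : alberti_crippa_mazzucato_quasi_self_similar)
    (h₂ : Torus.exists_unique_isClassicalScalarTransportForcedOn (d := Fin 2)) :
    cheskidov_noAnomaly_family :=
  cheskidov_noAnomaly_family_of_acm h₁.family h₂

end Assembly

end Literature.Analysis.FluidPDE.Gluing

end
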